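import Literature.AlgebraicGeometry.Hu2025.Statements.S01S09Interface.R110gSetupPrinted
import HarnessLib

/-!
# [Hu22] p.131 (proof of Thm 9.5): the printed-setting record of file g WITHOUT the literal «finite type over `Spec ℤ`» clause on
# `X` — OURS sibling, the non-vacuous carrier of the torus-quotient data at `𝔽 = ℚ` as well as `𝔽 = 𝔽_p` — row 110 file `h` =
# `S01S09Interface/R110hSetupPrintedOurs.lean`, STATEMENTS-FIRST (rung M-Hu-min, D-0089). res-type-024 gen 12.

**Status of the sources (D-0012): UNREFEREED PREPRINTS UNDER ADJUDICATION.** [Hu22] = Y. Hu, arXiv:2203.03842v4 (2022),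
pp.130–134 (page texts re-read this session); [Hu25] = arXiv:2507.21400v1, chunk p0072. WHY THIS FILE (typer note, HOME
STATUS 2026-08-27T10:27:05Z «VACUITY DISCLOSURE on g p523177»): file g's `Hu22Setup_printed` records «We apply Theorem 9.4 to
`X`» LITERALLY as `X_thm94 : IsAffineFiniteTypeOverInt X` (Thm 9.4, p.130 l.39–40: «an affine scheme of finite type over
`Spec ℤ`»). Together with the printed surjections `U ↠ X` (`U_onto`), `cell ↠ U` (`quot_surjective`) and the open immersion
`cell ⟶ Z_{Γ_d}` over `𝔽` (`cellToGamma`; `Z_Γ = gammaSpec (primaryFamily n 𝔽) …`, [Hu25] §8 «`𝔽 = ℚ` or `𝔽_p`»), every point of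
`X` then has residue characteristic `char 𝔽`; a nonempty affine scheme of finite type over `ℤ` has a closed point with finite
residue field, so at `𝔽 = ℚ` an inhabitant of `Hu22Setup_printed` has `X = ∅` (hence `cell = ∅` and an empty Prop-9.1 locus) —
the literal record is EMPTY at `𝔽 = ℚ` for every `d` realisable over `ℚ`, and `Hu22P131L40_printed` is vacuous there (stated
by hand in the note and re-derived by both lanes in their vacuity columns, res-ref-b11 10:34:49Z / res-ref-a10 10:34:25Z; not a
tree theorem; no verdict). This is the printed base tension of [Hu22] p.131 l.4–5 («`X` … of finite
presentation over a perfect field `k` … we assume that `X` is defined over `Spec ℤ`. We apply Theorem 9.4 to `X`»); [Hu22]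
itself treats `X` in this case over the PRIME FIELD `𝔽` (p.132 l.26–29 «`X` is a closed affine subscheme of `𝔸^m`»; p.133
l.16–18 «`J` be the ideal of `𝔽[x]` generated by `g_i(x)` … modulo the ideal of `X`»; p.134 l.25–27 «`ρ : X̃ → X` is a resolution
over the prime field `𝔽`, provided that `X` is defined over `ℤ`»). THIS FILE therefore adds, labelled OURS (reading: OURS — the
Spec-ℤ finite-type clause on `X` dropped, `X`'s base left to the consumer exactly as its integrality already is):
* `Hu22Setup_printed_ours L 𝔽 n d` = f's `Hu22Setup_ours` ((b) the Prop-9.1 range) + g's torus-quotient data `r_pos`, `hfree`,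
  `isoBarGr`, `quot_trivialises` ((a)), i.e. `Hu22Setup_printed` minus `X_thm94`;
* `Hu22Setup_printed.toPrintedOurs` = the forgetful map (every literal printed datum is an OURS datum);
* `Hu22P131L40_printed_ours S` = [Hu22] p.131 l.40–41 over it: `X` integral ⇒ `Z_{Γ_d}` integral (one step, as printed);
* `Hu22P132L30_asDefined S` = the p.132 l.30–51 sentence typed with the author's OWN definition of «`F`-fiber bundle» ([Hu22]
  p.134 l.22–24, verbatim «we say a morphism `f : Y → S` between two schemes `Y` and `S` is a `F`-fiber bundle for some fixed
  scheme `F` if `S` can be covered by an open subset `{O}` [sic] such that `f⁻¹(O)` is isomorphism [sic] to `O × F`»): the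
  isomorphisms `quot⁻¹(O) ≅ O × 𝔾^{n−1}_m` ABSTRACT (no compatibility with `quot` printed) — the AS-DEFINED sibling of g's
  `Hu22P132L30`, which reads «trivialization» (9.4) in the standard over-`O` sense; both over the literal e-setting.
Every decl is a candidate / structure / bookkeeping map tagged `[claim: Hu2022, status: under-review]`, consumed only as a
hypothesis, never asserted; no proofs, no `sorry`, no `instance`, no notation. EXISTENCE of an inhabitant is NOT shown (relative
to the unconstructed `L : LafforgueObjects`, R110c). No decl takes a side on joint J1 (tree index only:
`Hu2025/GammaSchemeNotIntegral*.lean`, `Hu2025/Proofs/S01S09Interface/GammaQuadHu22Setup(Lit).lean` are kernel statements about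
explicit data, never premises here). The literal records stay e (`Hu22Setup`), f (`Hu22Setup_ours`), g (`Hu22Setup_printed`).
AI typing is weaker than expert review. Universe `0`.
STATUS: candidate statements under adjudication (D-0012/D-0089); not asserted.
-/

noncomputable section

open _root_.CategoryTheory _root_.CategoryTheory.Limits _root_.AlgebraicGeometry

namespace Literature.AlgebraicGeometry.Hu2025.Statements.S01S09Interface

open Literature.AlgebraicGeometry.Hu2025.Statements.S08MainTheorem
open Literature.AlgebraicGeometry.Hu2025.Statements.S07GammaSchemes
open Literature.AlgebraicGeometry.Hu2025.Statements.S03Pluecker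

/-- **The setting of [Hu22] p.131 l.4–41 with the torus-quotient data of Thm 9.4, WITHOUT the literal «finite type over
`Spec ℤ`» clause on `X` — OURS sibling of g's `Hu22Setup_printed`** (same locators: Thm 9.4 p.130 l.39–50 = [Hu25] chunk p0072
l.118–124; p.131 l.4–16 «We identify `U ⊂ X × 𝔸^r` with the quotient space `Gr̄^{3,E}_d = Gr^{3,E}_d/(𝔾ⁿ_m/𝔾_m)`. Consider the
quotient map `π`»; l.27–28 Prop. 9.1 = the inherited `range_cellToGamma`; p.132 l.30–51 (9.4) for `quot_trivialises`). Fields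
beyond f's `Hu22Setup_ours`, exactly as in g: `r_pos` («a positive integer `r`»), `hfree : TorusFreeOnCell d` («acts freely»,
R110c's field-valued-points reading), `isoBarGr : U ≅ L.barGr n d hfree` («`U` is isomorphic to the quotient space `Gr̄_d`»,
R110c `Thm9_4` idiom over the [La03] datum `L`), `quot_trivialises` («the quotient map `π`» READ via the author's gloss p.132
l.30–51: a finite open cover of `U` over which `quot` is isomorphic over the base to `O × 𝔾^{n−1}_m → O`; READING — the action and
the equivariance are not typed). OMITTED on purpose: g's `X_thm94` (see the module docstring: with `U ↠ X`, `cell ↠ U`,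
`cell ⊂ Z_{Γ_d}` over `𝔽` it empties the record at `𝔽 = ℚ`); the base / finite-type hypothesis on `X` is left to the consumer
([Hu22] p.132–134 treat `X ⊂ 𝔸^m` over the prime field `𝔽`). Labelled OURS; the literal record is g's `Hu22Setup_printed`
(forgetful map `Hu22Setup_printed.toPrintedOurs`). **EXISTENCE / CONSTRUCTION NOT SHOWN (relative to the unconstructed `L`);
secondary ([La03] via [Hu25] §9); primary unread (acq-07745).** Universe `0`. [claim: Hu2022, status: under-review]
STATUS: candidate statement under adjudication (D-0012/D-0089); not asserted. -/
structure Hu22Setup_printed_ours (L : LafforgueObjects) (𝔽 : Type) [Field 𝔽] (n : ℕ) (M : HuMatroid n 3)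
    extends Hu22Setup_ours 𝔽 n M where
  /-- «there exists a positive integer `r`» (p.130 l.45–46) -/
  r_pos : 0 < r
  /-- «`(𝔾ⁿ_m/𝔾_m)` acts freely on the matroid Schubert cell `Gr^{3,E}_d`» (p.130 l.42–44; [Hu25] C72L121), READ at field-valued points (R110c) -/
  hfree : TorusFreeOnCell M
  /-- «`U` is isomorphic to the quotient space `Gr̄^{3,E}_d := Gr^{3,E}_d/(𝔾ⁿ_m/𝔾_m)`» (p.130 l.46–50; p.131 l.6–9), over the [La03]
  datum `L` as in R110c's `Thm9_4` -/
  isoBarGr : (U : Scheme.{0}) ≅ L.barGr n M hfree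
  /-- «the quotient map `π : Gr^{3,E}_d → Gr̄^{3,E}_d`» (p.131 l.10–16) of the free action, READ via p.132 l.30–51 ((9.4): a finite
  set `{O}` of opens of `U` with `Gr_d|_O ≅ O × (𝔾ⁿ_m/𝔾_m)`, split `𝔾^{n−1}_m`; READING, labelled; = g's `Hu22P132L30` of the
  underlying literal datum) -/
  quot_trivialises : ∃ (ι : Type) (_ : Finite ι) (O : ι → (U : Scheme.{0}).Opens), (⨆ j, O j) = ⊤ ∧
    ∀ j, ∃ e : ((quot ⁻¹ᵁ (O j) : cell.Opens) : Scheme.{0}) ≅ (splitTorusOver (n - 1) (O j : Scheme.{0}) : Scheme.{0}),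
      e.hom ≫ splitTorusOverProj (n - 1) (O j : Scheme.{0}) = quot ∣_ (O j)

/-- **Forgetful map: a literal printed datum (g's `Hu22Setup_printed`, with `X_thm94`) is an OURS datum** (drops the Spec-ℤ
finite-type clause on `X`; all other fields unchanged). OURS bookkeeping, so that anything stated over
`Hu22Setup_printed_ours` applies to the literal record. [claim: Hu2022, status: under-review]
STATUS: candidate statement under adjudication (D-0012/D-0089); not asserted. -/
def Hu22Setup_printed.toPrintedOurs {L : LafforgueObjects} {𝔽 : Type} [Field 𝔽] {n : ℕ} {M : HuMatroid n 3}
    (S : Hu22Setup_printed L 𝔽 n M) : Hu22Setup_printed_ours L 𝔽 n M where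
  toHu22Setup_ours := S.toHu22Setup_ours
  r_pos := S.r_pos
  hfree := S.hfree
  isoBarGr := S.isoBarGr
  quot_trivialises := S.quot_trivialises

/-- **Hu 2022 (arXiv:2203.03842v4), p.131 l.40–41 over the OURS printed-setting record** (joint J1 = G-H7's printed reason;
sibling of e's `Hu22P131L40`, f's `Hu22P131L40_ours`, g's `Hu22P131L40_printed`), verbatim: «As `X` is integral (by assumption),
one sees that `Z_Γ` is integral.» Typed as the INFERENCE it states, one step as printed, over `S : Hu22Setup_printed_ours L 𝔽 n d`:
`X` integral ⇒ `Z_Γ = gammaSpec (primaryFamily n 𝔽) (Γ_d ∩ Var_𝐔)` integral (Mathlib `IsIntegral`). Over a literal datum it is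
g's `Hu22P131L40_printed` (through `toPrintedOurs`, definitionally); unlike the literal record it is not emptied at `𝔽 = ℚ` by the
Spec-ℤ clause (module docstring). Labelled OURS. No side is taken on whether it follows (tree index only, see the module
docstring). [claim: Hu2022, status: under-review]
STATUS: candidate statement under adjudication (D-0012/D-0089); not asserted. -/
def Hu22P131L40_printed_ours {L : LafforgueObjects} {𝔽 : Type} [Field 𝔽] {n : ℕ} {M : HuMatroid n 3}
    (S : Hu22Setup_printed_ours L 𝔽 n M) : Prop :=
  IsIntegral S.X → IsIntegral (gammaSpec (primaryFamily n 𝔽) (GammaOfMatroidVar M))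

/-- **Hu 2022 (arXiv:2203.03842v4), p.132 l.30–51 typed with the author's definition of «`F`-fiber bundle» (p.134 l.22–24) —
AS-DEFINED sibling of g's `Hu22P132L30`.** p.132 (verbatim in g): «the quotient map `π` … is a principal `(𝔾ⁿ_m/𝔾_m)`-bundle …
Zariski locally trivial … we can over [sic] `Gr̄^{3,E}_d (≅ U)` by a finite set `{O}` of open subsets such that for any open subset
`O` in the cover, we have a trivialization (9.4) `Gr^{3,E}_d|_O ≅ O × (𝔾ⁿ_m/𝔾_m)`», split `𝔾^{n−1}_m` (l.46–51); p.134 l.22–24,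
verbatim: «Here, we say a morphism `f : Y → S` between two schemes `Y` and `S` is a `F`-fiber bundle for some fixed scheme `F` if
`S` can be covered by an open subset `{O}` [sic] such that `f⁻¹(O)` is isomorphism [sic] to `O × F`.» Typed over the LITERAL
setting `S : Hu22Setup 𝔽 n d` of file e exactly as that definition prints it: a finite index type `ι`, opens `O_j ⊂ U` covering
`U`, and for every `j` an isomorphism of schemes `quot⁻¹(O_j) ≅ O_j × 𝔾^{n−1}_m` (`splitTorusOver (n − 1) O_j`) — ABSTRACT, with
no compatibility with `quot` (none is printed in the definition). g's `Hu22P132L30` reads «trivialization» in the standard sense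
(the isomorphism over `O_j`: `e.hom ≫ proj = quot ∣_ O_j`) and implies this decl; the adjudication may read either (T5-style
pair; neither takes a side). [claim: Hu2022, status: under-review]
STATUS: candidate statement under adjudication (D-0012/D-0089); not asserted. -/
def Hu22P132L30_asDefined {𝔽 : Type} [Field 𝔽] {n : ℕ} {M : HuMatroid n 3} (S : Hu22Setup 𝔽 n M) : Prop :=
  ∃ (ι : Type) (_ : Finite ι) (O : ι → (S.U : Scheme.{0}).Opens), (⨆ j, O j) = ⊤ ∧
    ∀ j, Nonempty (((S.quot ⁻¹ᵁ (O j) : S.cell.Opens) : Scheme.{0}) ≅ (splitTorusOver (n - 1) (O j : Scheme.{0}) : Scheme.{0}))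

end Literature.AlgebraicGeometry.Hu2025.Statements.S01S09Interface

end
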